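import Mathlib
import HarnessLib.Audit

/-!
# Rung C1 of the crux `EulerZoomLiouville.PowerGaugeEulerLiouville`, NO-DRIFT lane (2a/3): TOOLS for the drift chart at an
# interior point of a transversally non-degenerate arc of zeros — a coordinate `f` with `|Df·W| ≤ K |W|²`

Route №10 `EulerZoomLiouville` (NavierStokesRegularity), crux E = stmt-NavierStokesRegularity-19832, tenure rung C1,
registered residue `stub_selfSimilarExtremalRest`.  Lineage ns-typeII-p2 (gen 7).  GENERIC CALCULUS on a
finite-dimensional real Hilbert space (no profile, no flow); companion of `…SelfSimilarCorankOneZeroCurve` (1/3).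

SETTING.  `W : E → E` is `C²`; `c` is a `C¹` curve on an open interval `(a, b) ∋ t₀` consisting of zeros of `W`
(`W (c t) = 0`); `e` is a unit vector and the BORDERED OPERATOR `T₀ = ⟪e, ·⟫ (c'(t₀) − L e) + L`, `L = DW(c t₀)`, is
a linear homeomorphism (⇔ `ker L = ℝ c'(t₀)`, `c'(t₀) ∉ range L`, `⟪e, c'(t₀)⟫ ≠ 0`: the zero `c(t₀)` is
transversally non-degenerate, `0` being a SIMPLE eigenvalue of `L`).  THE CHART is
`Θ(v) = c(⟪e, v⟫) + DW(c ⟪e, v⟫) (v − ⟪e, v⟫ e)` — affine in the fibre variable `h = v − ⟪e,v⟫e` — a local `C¹`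
diffeomorphism at `v₀ = t₀ e` onto a neighbourhood `D` of `c(t₀)` (`DΘ(v₀) = T₀`), and the DRIFT COORDINATE is
`f = ⟪e, Θ⁻¹(·)⟫` (so `f(c t) = t`), with fibre height `g = ‖(Θ⁻¹(·))_{⊥e}‖`.

THE ESTIMATE (`exists_driftChart`).  On the tube `{|f − t₀| < η, g < r} ⊆ D`:  **`|Df(y) W(y)| ≤ K ‖W(y)‖²`.**
Mechanism (no second derivatives of the chart are needed): for `y = Θ(te + h) = c(t) + L_t h` (`L_t = DW(c t)`),
Taylor gives `W(y) = L_t(L_t h) + R`, `‖R‖ ≤ M ‖L_t h‖²`; and `Df(y)(L_t L_t h) = 0` EXACTLY, because along the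
line `s ↦ te + h + s u₀` with `u₀ = L_t h − (⟪e, L_t h⟫/⟪e, c'(t)⟫) c'(t) ⊥ e` the chart moves by `s L_t u₀ = s L_t L_t h`
(`L_t c'(t) = 0`) while `f` stays equal to `t`; finally `‖L_t L_t h‖ ≥ μ‖h‖` uniformly near `t₀` (the operators
`L_t L_t + ⟪e,·⟫ c'(t₀)` are injective at `t₀`, `exists_sqBorderedEquiv`, and vary continuously), so
`‖y − c(t)‖ ≤ (2Λ/μ) ‖W(y)‖` on a thin tube.  Also recorded for the consumer: the closed tube
`{y ∈ D | |f − t₀| ≤ η, g ≤ r}` is compact; its lateral boundary `{g = r}` keeps a distance `d₀ > 0` from the zero set of `W`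
(zeros near `c(t₀)` are the arc points `c(t)`, which have `g = 0`); `f`, `g` are continuous on `D` with
`f(c t₀) = t₀`, `g(c t₀) = 0`.

Use (file 3/3): along a backward self-similar trajectory `s ↦ Φ₋ₛ x` clustering on a node arc, each passage through
the tube from `f ≈ t₀` to a cap `f = t₀ ± η` costs `≥ 3η/(4K)` of the finite budget `∫‖W(Φ₋ₛx)‖² ds`.

WHAT THIS IS NOT: not NS, not E, not rung C1 — calculus.  References: inverse function theorem, `C^r` case
(Mathlib `ContDiffAt.toOpenPartialHomeomorph`); B. Aulbach, LNM 1058 (1984), Thm 2.3 (the «asymptotic phase»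
statement whose geometric input this is; our construction is different and fact-free). [folklore]
-/

noncomputable section

open Set Filter Metric Function
open scoped Topology RealInnerProductSpace NNReal

-- flat `Theorems/<Route><Decl>…` files of one crux share the namespace of the crux (tree convention)
set_option linter.dupNamespace false

namespace Summit.NavierStokesRegularity.NavierStokesRegularity.Theorems.PowerGaugeEulerLiouville.NoDrift

variable {E : Type*} [NormedAddCommGroup E] [InnerProductSpace ℝ E]

/-! ### Linear algebra of the bordered operators -/

/-- The bordered operator acts as `T(αe + k) = α c' + L k` on `k ⊥ e` (`‖e‖ = 1`). [folklore] -/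
theorem bordered_apply_decomp {L : E →L[ℝ] E} {e c' : E} (he : ‖e‖ = 1) (α : ℝ) {k : E}
    (hk : ⟪e, k⟫ = 0) :
    ((innerSL ℝ e).smulRight (c' - L e) + L) (α • e + k) = α • c' + L k := by
  change (⟪e, α • e + k⟫ : ℝ) • (c' - L e) + L (α • e + k) = α • c' + L k
  have h1 : (⟪e, α • e + k⟫ : ℝ) = α := by
    rw [inner_add_right, inner_smul_right, real_inner_self_eq_norm_sq, he, hk]; ring
  rw [h1, map_add, map_smul, smul_sub]
  abel

/-- From the invertible bordered operator: `⟪e, c'⟫ ≠ 0` (given `L c' = 0`, `‖e‖ = 1`). [folklore] -/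
theorem inner_ne_zero_of_bordered {L : E →L[ℝ] E} {e c' : E} (he : ‖e‖ = 1) (hLc : L c' = 0)
    (T : E ≃L[ℝ] E) (hT : (T : E →L[ℝ] E) = (innerSL ℝ e).smulRight (c' - L e) + L) :
    ⟪e, c'⟫ ≠ 0 := by
  intro h0
  -- `T c' = 0`, so `c' = 0`
  have hTc : T c' = 0 := by
    change (T : E →L[ℝ] E) c' = 0
    rw [hT]
    change (⟪e, c'⟫ : ℝ) • (c' - L e) + L c' = 0
    rw [h0, hLc, zero_smul, add_zero]
  have hc0 : c' = 0 := T.injective (by rw [hTc, map_zero])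
  -- then `T e = 0`, so `e = 0`
  have hTe : T e = 0 := by
    change (T : E →L[ℝ] E) e = 0
    rw [hT]
    change (⟪e, e⟫ : ℝ) • (c' - L e) + L e = 0
    rw [real_inner_self_eq_norm_sq, he, hc0]
    simp
  have he0 : e = 0 := T.injective (by rw [hTe, map_zero])
  rw [he0, norm_zero] at he
  exact zero_ne_one he

/-- From the invertible bordered operator: if `α c' + L k = 0` with `k ⊥ e` then `α = 0` and `k = 0`. [folklore] -/
theorem eq_zero_of_bordered {L : E →L[ℝ] E} {e c' : E} (he : ‖e‖ = 1)
    (T : E ≃L[ℝ] E) (hT : (T : E →L[ℝ] E) = (innerSL ℝ e).smulRight (c' - L e) + L) {α : ℝ} {k : E}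
    (hk : ⟪e, k⟫ = 0) (h : α • c' + L k = 0) : α = 0 ∧ k = 0 := by
  have hT0 : T (α • e + k) = 0 := by
    change (T : E →L[ℝ] E) (α • e + k) = 0
    rw [hT, bordered_apply_decomp he α hk, h]
  have hw : α • e + k = 0 := T.injective (by rw [hT0, map_zero])
  have hα : α = 0 := by
    have h1 : (⟪e, α • e + k⟫ : ℝ) = 0 := by rw [hw, inner_zero_right]
    rw [inner_add_right, inner_smul_right, real_inner_self_eq_norm_sq, he, hk] at h1
    simpa using h1
  refine ⟨hα, ?_⟩
  rw [hα, zero_smul, zero_add] at hw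
  exact hw

/-- **THE SQUARED BORDERED OPERATOR IS INVERTIBLE.**  If `L c' = 0`, `‖e‖ = 1` and `⟪e, ·⟫(c' − L e) + L` is a linear
homeomorphism, then so is `L ∘ L + ⟪e, ·⟫ c'` (finite dimension: injectivity suffices).  Injectivity: if
`L L u + ⟪e,u⟫ c' = 0`, bordering `w = ⟪e,u⟫ e + (L u − β c')` (`β` chosen with the second summand `⊥ e`) gives
`T w = 0`, whence `⟪e,u⟫ = 0` and `L u = β c'`; `c' ∉ range L` (else `T` kills a vector `e + k`) forces `L u = 0`, and
then `T u = 0`. [folklore] -/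
theorem exists_sqBorderedEquiv [FiniteDimensional ℝ E] {L : E →L[ℝ] E} {e c' : E} (he : ‖e‖ = 1)
    (hLc : L c' = 0) (T : E ≃L[ℝ] E) (hT : (T : E →L[ℝ] E) = (innerSL ℝ e).smulRight (c' - L e) + L) :
    ∃ N : E ≃L[ℝ] E, (N : E →L[ℝ] E) = L.comp L + (innerSL ℝ e).smulRight c' := by
  have hee : (⟪e, e⟫ : ℝ) = 1 := by rw [real_inner_self_eq_norm_sq, he]; norm_num
  have hec : (⟪e, c'⟫ : ℝ) ≠ 0 := inner_ne_zero_of_bordered he hLc T hT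
  set N' : E →L[ℝ] E := L.comp L + (innerSL ℝ e).smulRight c' with hN'
  -- `c' ∉ range L`
  have hrange : ∀ q : E, L q ≠ c' := by
    intro q hq
    -- `q = ζ e + n`, `n ⊥ e`; `k := -n - ζ e + (ζ/⟪e,c'⟫) c'` is `⊥ e` with `L k = -c'`
    set ζ : ℝ := ⟪e, q⟫
    set n : E := q - ζ • e
    have hn : (⟪e, n⟫ : ℝ) = 0 := by
      simp only [n, ζ, inner_sub_right, inner_smul_right, hee]; ring
    set k : E := -n - ζ • e + (ζ / ⟪e, c'⟫) • c'
    have hk : (⟪e, k⟫ : ℝ) = 0 := by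
      simp only [k, inner_add_right, inner_sub_right, inner_neg_right, inner_smul_right, hn, hee]
      field_simp
      ring
    have hLk : L k = -c' := by
      have hq' : q = ζ • e + n := by simp [n]
      have : L n + ζ • L e = c' := by
        rw [← hq]; rw [hq', map_add, map_smul]; abel
      simp only [k, map_add, map_sub, map_neg, map_smul, hLc, smul_zero, add_zero]
      rw [← this]; abel
    have h := eq_zero_of_bordered he T hT (α := 1) hk (by rw [hLk]; simp)
    exact one_ne_zero h.1
  -- injectivity of `N'`
  have hinj : Function.Injective N' := by
    refine (injective_iff_map_eq_zero N').2 fun u hu => ?_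
    have hu' : L (L u) + (⟪e, u⟫ : ℝ) • c' = 0 := hu
    set β : ℝ := ⟪e, L u⟫ / ⟪e, c'⟫
    set m : E := L u - β • c'
    have hm : (⟪e, m⟫ : ℝ) = 0 := by
      simp only [m, β, inner_sub_right, inner_smul_right]
      field_simp
      ring
    have hLm : L m = L (L u) := by simp [m, map_sub, map_smul, hLc]
    -- `T (⟪e,u⟫ e + m) = ⟪e,u⟫ c' + L L u = 0`
    obtain ⟨hα, hm0⟩ := eq_zero_of_bordered he T hT (α := ⟪e, u⟫) hm (by rw [hLm, add_comm]; exact hu')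
    -- so `L u = β c'`, and `c' ∉ range L` forces `β = 0`
    have hLu : L u = β • c' := by
      have : L u - β • c' = 0 := hm0
      exact sub_eq_zero.1 this
    have hβ : β = 0 := by
      by_contra hβ
      exact hrange (β⁻¹ • u) (by rw [map_smul, hLu, smul_smul, inv_mul_cancel₀ hβ, one_smul])
    have hLu0 : L u = 0 := by rw [hLu, hβ, zero_smul]
    -- finally `T u = ⟪e,u⟫ (c' − L e) + L u = 0`
    have hdec : u = (⟪e, u⟫ : ℝ) • e + (u - (⟪e, u⟫ : ℝ) • e) := by abel
    have hk2 : (⟪e, u - (⟪e, u⟫ : ℝ) • e⟫ : ℝ) = 0 := by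
      simp only [inner_sub_right, inner_smul_right, hee]; ring
    have hL2 : L (u - (⟪e, u⟫ : ℝ) • e) = 0 := by
      rw [map_sub, map_smul, hLu0, hα, zero_smul, sub_zero]
    obtain ⟨-, hk0⟩ := eq_zero_of_bordered he T hT (α := ⟪e, u⟫) hk2 (by rw [hL2, hα, zero_smul, add_zero])
    rw [hdec, hk0, hα, zero_smul, add_zero]
  set Nl : E ≃ₗ[ℝ] E := (N' : E →ₗ[ℝ] E).linearEquivOfInjective hinj rfl with hNl
  refine ⟨Nl.toContinuousLinearEquiv, ?_⟩
  ext u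
  rfl

/-! ### Taylor remainder of a `C²` map on a ball -/

/-- **Second-order Taylor bound on a ball.**  For `W` of class `C²` and a closed ball `B̄(z, R)` there is `M ≥ 0`
with `‖W y − W p − DW(p)(y − p)‖ ≤ M ‖y − p‖²` for all `p, y ∈ B̄(z, R)` (`DW` is Lipschitz on the compact convex
ball; mean value inequality along the segment). [folklore] -/
theorem exists_taylor_two_bound [CompleteSpace E] {W : E → E} (hW : ContDiff ℝ 2 W)
    [ProperSpace E] (z : E) (R : ℝ) :
    ∃ M : ℝ, 0 ≤ M ∧ ∀ p ∈ closedBall z R, ∀ y ∈ closedBall z R,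
      ‖W y - W p - fderiv ℝ W p (y - p)‖ ≤ M * ‖y - p‖ ^ 2 := by
  have hDW : ContDiff ℝ 1 (fderiv ℝ W) := hW.fderiv_right (m := 1) le_rfl
  have hDWd : Differentiable ℝ (fderiv ℝ W) := hDW.differentiable (by simp)
  have hcont : Continuous (fderiv ℝ (fderiv ℝ W)) := hDW.continuous_fderiv (by simp)
  -- bound of the second derivative on the compact ball
  obtain ⟨M, hM⟩ := (isCompact_closedBall z R).exists_bound_of_continuousOn
    (f := fderiv ℝ (fderiv ℝ W)) hcont.continuousOn
  refine ⟨max M 0, le_max_right _ _, fun p hp y hy => ?_⟩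
  have hM' : ∀ x ∈ closedBall z R, ‖fderiv ℝ (fderiv ℝ W) x‖ ≤ max M 0 := fun x hx =>
    (hM x hx).trans (le_max_left _ _)
  -- `DW` is `max M 0`-Lipschitz on the ball
  have hLip : ∀ x ∈ closedBall z R, ‖fderiv ℝ W x - fderiv ℝ W p‖ ≤ max M 0 * ‖x - p‖ := fun x hx =>
    (convex_closedBall z R).norm_image_sub_le_of_norm_fderiv_le (fun x _ => hDWd x) hM' hp hx
  -- mean value inequality on the segment `[p, y]` with `φ = DW p`
  have hseg : segment ℝ p y ⊆ closedBall z R := (convex_closedBall z R).segment_subset hp hy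
  have hbound : ∀ x ∈ segment ℝ p y, ‖fderiv ℝ W x - fderiv ℝ W p‖ ≤ max M 0 * ‖y - p‖ := by
    intro x hx
    refine (hLip x (hseg hx)).trans (mul_le_mul_of_nonneg_left ?_ (le_max_right _ _))
    -- points of the segment are within `‖y - p‖` of `p`
    rw [← dist_eq_norm, ← dist_eq_norm]
    have h := (convex_closedBall p (dist y p)).segment_subset (mem_closedBall_self dist_nonneg)
      (mem_closedBall.2 le_rfl) hx
    exact mem_closedBall.1 h
  have h := (convex_segment p y).norm_image_sub_le_of_norm_fderiv_le'
    (fun x _ => (hW.differentiable (by norm_num)) x) hbound (left_mem_segment ℝ p y)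
    (right_mem_segment ℝ p y)
  calc ‖W y - W p - fderiv ℝ W p (y - p)‖ ≤ max M 0 * ‖y - p‖ * ‖y - p‖ := h
    _ = max M 0 * ‖y - p‖ ^ 2 := by ring

end Summit.NavierStokesRegularity.NavierStokesRegularity.Theorems.PowerGaugeEulerLiouville.NoDrift

end
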